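import Summits.ABC.ABC.Theorems.TowerFourSubLiouville.Negative.TwoExponentDiagram

/-!
# `TowerFourSubLiouville` (stmt-ABC-1649): the anchored slice (Dc2) is not easier than height `2` — corner `(1, 2)` inside it

Negative-side module of the standing disprover (cycle 12, refuter-cdisprove-stmt-ABC-1649-g12-0, 2026-08-17), companion of
`Negative.TorusBezoutCorner` (p138228: the unit slice Dc1, `not_ubqOn_unitSlice_of_two_lt`) and `Negative.TwoExponentDiagram`
(p126869: the corners of the `(θ, φ)` diagram).

The strategist's second typed split of the crux-equivalent core (`Cruxes/TowerFourSubLiouville/StrategistSketch.lean`, §5 Dc2 of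
`STRATEGY-CENSUS.md`) is along the ANCHORED SLICE

  `anchoredSlice B v w Y Z := ∃ p q, 0 < p ≤ B, 0 < q ≤ B, p⁴v ≠ q⁴w, 2·|p⁴v − q⁴w|² ≤ q⁴w`

("`w/v` within `w^{−1/2}` of a fourth power of height `≤ B`": the hypergeometric / Thue–Siegel stratum S1), with the claim "ON:
provable now … effective and uniform — genuine; OFF: the crux".  This file records the dial of the ON-piece `UBQOn (anchoredSlice B) η`
(matrices VERBATIM, spelled out; no definitions are added):

* `not_ubqOn_anchoredSlice_of_two_lt`: **for every `B ≥ 1` and every `η > 2` the ON-piece is FALSE.**  Witness: the `z = 1`, `d = 1`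
  tight identity `(s+2)(2s−1)⁴ − (s−2)(2s+1)⁴ = 80s² + 4` on the progression `s = 6m + 3` (coprimality), i.e.
  `v = 6m+1`, `w = 6m+5 = v + 4`, `Y = 12m+7`, `Z = 12m+5`, `wZ⁴ − vY⁴ = 2880m² + 2880m + 724 ≤ 81 Z²`
  (`anchoredFamily_identity`, `exists_anchoredFamily`): anchored at `p = q = 1` with anchor error `|v − w| = 4` (so in the slice as
  soon as `w ≥ 32`), coefficient height `w ≤ Z`, value `≍ 20 Z²` — the corner **`(1, 2)`** of the two-exponent diagram realised
  INSIDE the anchored slice with the best possible anchor (bounded error).  So Dc2's ON-piece, like Dc1's, is false above `η = 2`.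
* `ubqOn_anchoredSlice_zero`: for `B = 0` the slice is empty and the ON-piece holds vacuously — the hypothesis `1 ≤ B` is needed.

Remarks for the provers (docstring only).  (i) The family has bounded anchor error, the regime where the hypergeometric method is
at its strongest (effective irrationality exponent `→ 2` for `⁴√(1 + 4/v)`), and its value `≍ Z²` at `θ = 1` shows that on this
sub-slice nothing better than `φ = 2` can hold — consistent with the disprover's § (11d) "anchoring never goes below `Z²`".
(ii) The slice AS TYPED admits anchor errors `a₀ = |p⁴v − q⁴w|` up to `(q⁴w/2)^{1/2}`, whereas Thue–Siegel/hypergeometric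
arguments beat Liouville only for `a₀ ≲ (q⁴w)^{1/3}` (irrationality exponent `1 + log(c·q⁴w)/log(c'·q⁴w/a₀²) < 4`); on the band
`(q⁴w)^{1/3} ≪ a₀ ≪ (q⁴w)^{1/2}` no engine is on record, so "ON: provable now" should be read for a narrower slice (exponent `3` in
place of `2` in the last conjunct), and for which `η` it is provable is not stated in the census.  (iii) Heuristically (random model
restricted to the slice: `≍ Z^{θ/2 + φ − 2}` anchored enemies per dyadic block) the ON-piece's diagonal truth is `η = 4/3`, its
proved ceiling is `2` (here), and `ABC` gives every `η < 8/13` (p137739, valid on any slice).  Calibration, not a kill.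
-/

-- `Summit.ABC.ABC` is the mandated summit-side namespace (CONVENTIONS §2); the duplicate is deliberate.
set_option linter.dupNamespace false

namespace Summit.ABC.ABC.Theorems.TowerFourSubLiouville.Negative

/-! ## The anchored family `(6m+5)(12m+5)⁴ − (6m+1)(12m+7)⁴ = 2880m² + 2880m + 724` -/

/-- The identity (the shape `(1; 1, 2)` normal form `(s+2)(2s−1)⁴ − (s−2)(2s+1)⁴ = 80s² + 4` at `s = 6m + 3`). -/
theorem anchoredFamily_identity (m : ℕ) :
    (6 * m + 5) * (12 * m + 5) ^ 4 = (6 * m + 1) * (12 * m + 7) ^ 4 + (2880 * m ^ 2 + 2880 * m + 724) := by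
  ring

/-- Coprimality `gcd(vY, wZ) = 1` along the family: `1 = vY·(1 − 2g − (4m+3)g²) + wZ·(4m+1)g²` with `g = 36m² + 27m + 3`
(`vY = 1 + 2g`, `(4m+1)·wZ − (4m+3)·vY = 4`). -/
theorem anchoredFamily_coprime (m : ℕ) :
    Nat.Coprime ((6 * m + 1) * (12 * m + 7)) ((6 * m + 5) * (12 * m + 5)) :=
  coprime_of_int_combination (r := 1)
    (a := 1 - 2 * (36 * (m : ℤ) ^ 2 + 27 * m + 3) - (4 * m + 3) * (36 * (m : ℤ) ^ 2 + 27 * m + 3) ^ 2)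
    (b := (4 * (m : ℤ) + 1) * (36 * (m : ℤ) ^ 2 + 27 * m + 3) ^ 2)
    (by push_cast; ring) (Nat.coprime_one_left _)

/-- **The family packaged**: beyond every height a coprime quadruple with `wZ⁴ = vY⁴ + a`, `0 < a ≤ 81 Z²`, `w = v + 4 ≤ Z`, `w ≥ 32`. -/
theorem exists_anchoredFamily (N : ℕ) : ∃ v w Y Z a : ℕ, N ≤ Z ∧ 0 < v ∧ 0 < w ∧ 0 < Y ∧ 1 ≤ Z ∧
    Nat.Coprime (v * Y) (w * Z) ∧ w * Z ^ 4 = v * Y ^ 4 + a ∧ 0 < a ∧ a ≤ 81 * Z ^ 2 ∧ w ≤ Z ∧ 32 ≤ w ∧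
    w = v + 4 := by
  set m : ℕ := max N 5 with hm
  have hm5 : 5 ≤ m := le_max_right _ _
  have hNm : N ≤ m := le_max_left _ _
  refine ⟨6 * m + 1, 6 * m + 5, 12 * m + 7, 12 * m + 5, 2880 * m ^ 2 + 2880 * m + 724, by omega, by omega, by omega,
    by omega, by omega, anchoredFamily_coprime m, anchoredFamily_identity m, by positivity, ?_, by omega, by omega, by omega⟩
  nlinarith [Nat.zero_le (m ^ 2), Nat.zero_le m]

/-- The two smallest members in the slice (`m = 5, 6`): `35·65⁴ − 31·67⁴ = 87124`, `41·77⁴ − 37·79⁴ = 121684`; and the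
first member of the progression, `5·5⁴ − 1·7⁴ = 724` (not yet anchored: `w = 5 < 32`). -/
example : (35 : ℕ) * 65 ^ 4 = 31 * 67 ^ 4 + 87124 ∧ (41 : ℕ) * 77 ^ 4 = 37 * 79 ^ 4 + 121684 ∧
    (5 : ℕ) * 5 ^ 4 = 1 * 7 ^ 4 + 724 := by norm_num

/-! ## The ON-piece of the anchored split is false above `η = 2` -/

/-- **Dc2 calibrated: `UBQOn (anchoredSlice B) η` is FALSE for every `B ≥ 1`, `η > 2`** (matrices of `StrategistSketch.UBQOn` and
`StrategistSketch.anchoredSlice` verbatim).  The anchored family is in the slice with `p = q = 1` (anchor error `4`, `2·4² = 32 ≤ w`),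
has height `max(v,w) = w ≤ Z ≤ Z^η` and value `≤ 81 Z² < Z^η` eventually. -/
theorem not_ubqOn_anchoredSlice_of_two_lt (B : ℕ) (hB : 1 ≤ B) (η : ℝ) (hη : 2 < η) :
    ¬ ∃ Z₀ : ℕ, ∀ v w Y Z : ℕ, Z₀ ≤ Z →
      (∃ p q : ℕ, 0 < p ∧ 0 < q ∧ p ≤ B ∧ q ≤ B ∧ p ^ 4 * v ≠ q ^ 4 * w ∧
        2 * (((p ^ 4 * v : ℕ) : ℤ) - ((q ^ 4 * w : ℕ) : ℤ)).natAbs ^ 2 ≤ q ^ 4 * w) →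
      0 < v → 0 < w → 0 < Y → Nat.Coprime (v * Y) (w * Z) →
      ((max v w : ℕ) : ℝ) ≤ (Z : ℝ) ^ η → w * Z ^ 4 ≠ v * Y ^ 4 →
      (Z : ℝ) ^ η < |((w * Z ^ 4 : ℕ) : ℝ) - ((v * Y ^ 4 : ℕ) : ℝ)| := by
  rintro ⟨Z₀, h⟩
  obtain ⟨N₁, hN₁⟩ := eventually_const_mul_rpow_le 81 2 η hη
  obtain ⟨v, w, Y, Z, a, hNZ, hv, hw, hY, hZ1, hcop, hid, ha, ha81, hwZ, hw32, hwv⟩ :=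
    exists_anchoredFamily (max Z₀ N₁)
  have hZ₀ : Z₀ ≤ Z := le_trans (le_max_left _ _) hNZ
  have h1 := hN₁ Z (le_trans (le_max_right _ _) hNZ)
  rw [show ((Z : ℝ) ^ (2 : ℝ)) = (Z : ℝ) ^ (2 : ℕ) from by rw [← Real.rpow_natCast]; norm_num] at h1
  have hZR : (1 : ℝ) ≤ Z := by exact_mod_cast hZ1
  -- the anchor `p = q = 1`
  have hanchor : ∃ p q : ℕ, 0 < p ∧ 0 < q ∧ p ≤ B ∧ q ≤ B ∧ p ^ 4 * v ≠ q ^ 4 * w ∧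
      2 * (((p ^ 4 * v : ℕ) : ℤ) - ((q ^ 4 * w : ℕ) : ℤ)).natAbs ^ 2 ≤ q ^ 4 * w := by
    refine ⟨1, 1, one_pos, one_pos, hB, hB, ?_, ?_⟩
    · simp only [one_pow, one_mul]; omega
    · have hdiff : (((1 ^ 4 * v : ℕ) : ℤ) - ((1 ^ 4 * w : ℕ) : ℤ)) = -4 := by
        rw [hwv]; push_cast; ring
      rw [hdiff]
      simp only [one_pow, one_mul]
      show 2 * Int.natAbs (-4) ^ 2 ≤ w
      norm_num
      exact hw32
  -- height and value
  have hmax : ((max v w : ℕ) : ℝ) ≤ (Z : ℝ) ^ η := by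
    rw [max_eq_right (by omega : v ≤ w)]
    calc (w : ℝ) ≤ (Z : ℝ) := by exact_mod_cast hwZ
      _ = (Z : ℝ) ^ (1 : ℝ) := (Real.rpow_one _).symm
      _ ≤ (Z : ℝ) ^ η := Real.rpow_le_rpow_of_exponent_le hZR (by linarith)
  have hne : w * Z ^ 4 ≠ v * Y ^ 4 := by rw [hid]; omega
  have key := h v w Y Z hZ₀ hanchor hv hw hY hcop hmax hne
  have habs : |((w * Z ^ 4 : ℕ) : ℝ) - ((v * Y ^ 4 : ℕ) : ℝ)| = (a : ℝ) := by
    rw [hid]; push_cast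
    rw [show (((v : ℝ) * (Y : ℝ) ^ 4 + (a : ℝ)) - (v : ℝ) * (Y : ℝ) ^ 4) = (a : ℝ) by ring]
    exact abs_of_nonneg (by positivity)
  rw [habs] at key
  have ha81R : (a : ℝ) ≤ 81 * (Z : ℝ) ^ 2 := by exact_mod_cast ha81
  linarith

/-- **`B ≥ 1` is needed**: for `B = 0` the anchored slice is empty and the ON-piece holds vacuously (with `Z₀ = 0`), for every `η`. -/
theorem ubqOn_anchoredSlice_zero (η : ℝ) :
    ∃ Z₀ : ℕ, ∀ v w Y Z : ℕ, Z₀ ≤ Z →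
      (∃ p q : ℕ, 0 < p ∧ 0 < q ∧ p ≤ 0 ∧ q ≤ 0 ∧ p ^ 4 * v ≠ q ^ 4 * w ∧
        2 * (((p ^ 4 * v : ℕ) : ℤ) - ((q ^ 4 * w : ℕ) : ℤ)).natAbs ^ 2 ≤ q ^ 4 * w) →
      0 < v → 0 < w → 0 < Y → Nat.Coprime (v * Y) (w * Z) →
      ((max v w : ℕ) : ℝ) ≤ (Z : ℝ) ^ η → w * Z ^ 4 ≠ v * Y ^ 4 →
      (Z : ℝ) ^ η < |((w * Z ^ 4 : ℕ) : ℝ) - ((v * Y ^ 4 : ℕ) : ℝ)| := by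
  refine ⟨0, fun v w Y Z _ hP _ _ _ _ _ _ => ?_⟩
  obtain ⟨p, q, hp, -, hpB, -⟩ := hP
  omega

end Summit.ABC.ABC.Theorems.TowerFourSubLiouville.Negative
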